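import Summits.HodgeConjecture.HodgeConjecture.Theorems.SixfoldTableXCoverK3PDegenerate
import Literature.AlgebraicGeometry.HodgeTheory.CentreTimesCMCurveNoEmbedding
import HarnessLib

/-!
# TABLE X (dimension 6) — more members of the K3-partner cell certified OUTSIDE the degenerate sub-cell: `Y × E′ × E″`,
# `Y` a simple quartic-centre fourfold of signature `{(2,0),(1,1)}`, `E′, E″` CM elliptic curves whose CM fields do not
# embed into the centre `E = End⁰(Y)` nor (for `E″`) into `End⁰(E′)` (cell `pub-hodgeav-hg6`, req-37 (A) Q2b; eng-2 g7,
# lead g4 2026-08-29T07:12:49Z, brick R25-6)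

HONEST FRAMING. HC, `HC_AV` (stmt-1333), `HC_CM` (stmt-3052) and the rung H2 are NOT proved and do not occur here. KERNEL
ONLY: theorems over existing declarations; no definition, no `sorry`, no new named fact; nothing landed is edited. KIND of
`HC_CM`: ABSENT (the curves are CM, but HC is obtained from `B = D`).

WHICH MEMBERS (lead g4's question). The K3-partner cell `ProdCMCell IsQuarticFieldTypeIVFourfold (dim = 2)` = «`A ∼ Y × Z`,
`Y` a simple quartic-field type-IV fourfold, `Z` ANY CM surface» also contains the members with `Z` NON-simple, `Z ∼ E′ × E″` a
product of CM elliptic curves. By the cell's engines (J4 `jobs/J4-eng2/README.md`: only `E_{k₁} × E_{k₂} × Y₄/M`, `M`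
biquadratic ∋ `k₁, k₂` (row 26) and `E_k² × Y₄/M` (row 27) interact) these have `B = D` unless `E = End⁰(Y)` is biquadratic
and contains the CM field of a curve (the Weil ∕ K3P members of rows 26 ∕ 27). `IsQuarticFieldTypeIVFourfold` together with
simplicity forces the `E`-signature `{(2,0),(1,1)}` (Shimura 1963 Thm. 5 (4), tree `Ring2/RowFourClosed`: `r_ν = s_ν = 1` for
all `ν` never occurs for a simple `X`), so `Y` is taken in R10's explicit class as in `SixfoldTableXRow25NonAligned`.

WHAT IS PROVED (one-liners over the tree's Moonen–Zarhin Prop. (3.8) files `CentreTimesCMCurveNoEmbedding` ∕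
`CentreTimesCMCurveProductSpan` and R10's `B(Yⁿ) = D(Yⁿ)`):
* §1 **`isStablyNondegenerate_quarticCentre_prod_cmCurve_prod_cmCurve`**: for `Y` in R10's class, `E′`, `E″` elliptic curves with
  `χ′ ≫ χ′ = -d′`, `χ″ ≫ χ″ = -d″` (`d′, d″ > 0`) and the NO-EMBEDDING data
  `hno′ : ∀ z ∈ Z(End⁰ Y), z² ≠ -d′`, `hno″ : ∀ z ∈ Z(End⁰ Y), z² ≠ -d″` (the CM fields `ℚ(√-d′)`, `ℚ(√-d″)` do not embed into
  `E`), `hnoE′ : ∀ z ∈ Z(End⁰ E′), z² ≠ -d″` (`ℚ(√-d″)` is not the CM field of `E′`: not the «same field twice» case):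
  `(Y × E′) × E″` is stably nondegenerate — `AbelianVariety.isStablyNondegenerate_of_quarticCM` ▸
  `IsStablyNondegenerate.prod_cmCurve_of_isSimple` ▸ `IsStablyNondegenerate.prod_prod_cmCurve_of_isSimple`.
* §2 `isStablyNondegenerate_row25_cmCurves_of_noEmbedding` ∕ **`hodgeConjectureFor_row25_cmCurves_of_noEmbedding`**: `B = D` on all
  powers and HC at every `A ∼ Y × (E′ × E″)` — UNCONDITIONAL under the member data.
* §3 **`not_k3pDegenerate_of_quarticCentre_prod_cmCurves`**: these members are OUTSIDE the narrowed binder class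
  `{A in the K3P cell : ¬ IsStablyNondegenerate A}` of `SixfoldTableXCoverK3PDegenerate` (R25-5, p705362).

v2 (same session): the «SAME CM FIELD TWICE» case. §4 **`isStablyNondegenerate_quarticCentre_prod_cmCurve_sq`**: `Y × (E′ × E′)`
is stably nondegenerate as soon as `ℚ(√-d′) ⊄ E` (`hno′` alone) — NOT by Prop. (3.8) (`Hom(E′, Y × E′) ≠ 0`) but as a RETRACT
of a power of the stably nondegenerate `Y × E′`: the tree's `IsStablyNondegenerate.powSucc_prod_powSucc` (mixed powers
`Y^{M+1} × E′^{N+1}`, van Geemen §2.4–2.5 ∕ §3.6) at `(M, N) = (0, 1)`; hence every `A ∼ Y × (E′ × E″)` with `E″ ∼ E′`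
(`…_cmCurves_of_isIsogenous`) is stably nondegenerate, satisfies HC, and is certified OUTSIDE the degenerate sub-cell
(`not_k3pDegenerate_of_quarticCentre_prod_cmCurves_of_isIsogenous`). With §1–§3 this covers `Z ∼ E′ × E″` for ALL pairs of CM
curves whose fields do not embed into `E` — split as «`E″ ∼ E′`» or «`ℚ(√-d″) ⊄ End⁰(E′)`» (for CM elliptic curves the two
cases are exhaustive in words: `Hom(E″, E′) ≠ 0` iff the CM fields agree; that dichotomy is not re-typed here).

READING (three-clause form). (i) KERNEL: the K3P members `A ∼ Y × (E′ × E″)` with the three no-embedding data are stably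
nondegenerate, satisfy HC, and are certified outside the degenerate sub-cell — unconditional, std axioms; (ii) modulo nothing
displayed (the `hno`'s are member data: `k′, k″ ⊄ E`, `k″ ≠ k′`); (iii) NOT certified: `Z ∼ E′ × E″` with the SAME CM field twice
(`k′ = k″ ⊄ E`, incl. `E′²`; `B = D` by the engines — Moonen–Zarhin Prop. (3.8) needs `Hom(E, X) = 0`, so a slot argument over
`Y × E′` is required, not in tree shape), the Weil ∕ K3P members `k ⊂ E` biquadratic (rows 26 ∕ 27 — degenerate, they STAY in the
binder), the aligned K3 partners (rows 23 ∕ 24); HC ∕ `HC_AV` ∕ `HC_CM` ∕ H2. No inhabitant is exhibited and none is invented;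
typed ≠ proved.
-/

set_option linter.dupNamespace false

noncomputable section

open CategoryTheory NumberField
open Literature.AlgebraicGeometry Literature.AlgebraicGeometry.Motives
open Literature.AlgebraicGeometry.Motives.AbelianVariety (IsIsogenous IsSimple isSimple_of_dim_le_one powSucc powSucc_zero
  powSucc_succ)
open Literature.AlgebraicGeometry.HodgeTheory
open Literature.AlgebraicGeometry.ComplexMultiplication
open Literature.AlgebraicGeometry.Milne1999
open Literature.AlgebraicTopology.SingularHomology
open Literature.Barriers.HodgeConjecture
open Summit.HodgeConjecture.HodgeConjecture.Ring2.ClassTargets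
open Summit.HodgeConjecture.HodgeConjecture.Ring2.Motiv (ProdCMCell)
open Summit.HodgeConjecture.HodgeConjecture.Ring2.Atlas (IsQuarticFieldTypeIVFourfold)

namespace Summit.HodgeConjecture.HodgeConjecture.TableX

section CMCurves

variable {Y E' E'' : AbelianVariety ℂ} {φY : Y ⟶ Y} {μ₁ μ₂ : ℂ} {χ' : E' ⟶ E'} {χ'' : E'' ⟶ E''} {d' d'' : ℕ}

/-! ## §1 `(Y × E′) × E″` is stably nondegenerate under the no-embedding data -/

/-- **`(Y × E′) × E″` is stably nondegenerate** — `Y` a simple fourfold with quartic CM centre of signature `{(2,0),(1,1)}`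
(R10's class), `E′, E″` elliptic curves with `χ′ ≫ χ′ = -d′`, `χ″ ≫ χ″ = -d″`, and no central endomorphism of `Y` of square
`-d′` or `-d″`, no central endomorphism of `E′` of square `-d″` (Moonen–Zarhin Prop. (3.8) twice: `Hg(Y × E′) = Hg(Y) × Hg(E′)`,
then `Hg((Y × E′) × E″) = Hg(Y × E′) × Hg(E″)`; `B(Yⁿ) = D(Yⁿ)` by Thm. (0.2)(4)). UNCONDITIONAL.
[cite: MoonenZarhin1999LowDim, §3 Prop. (3.8), Thm. (3.2) and Thm. (0.2)(4)] [cite: Gordon1999HodgeAVSurvey, Def. 7.6] -/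
theorem isStablyNondegenerate_quarticCentre_prod_cmCurve_prod_cmCurve (hYs : Y.IsSimple)
    (hE4 : Module.finrank ℚ Y.endAlgebra = 4) (h11 : starRingEnd ℂ μ₁ ≠ μ₁) (h22 : starRingEnd ℂ μ₂ ≠ μ₂) (h12 : μ₂ ≠ μ₁)
    (h12' : μ₂ ≠ starRingEnd ℂ μ₁) (h1 : eigenMultiplicity Y φY μ₁ = 1)
    (h1' : eigenMultiplicity Y φY (starRingEnd ℂ μ₁) = 1) (h2 : eigenMultiplicity Y φY μ₂ = 2) (hY4 : Y.dim = 4)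
    (hE'1 : E'.dim = 1) (hd' : 0 < d') (hχ' : χ' ≫ χ' = -(d' • 𝟙 E')) (hE''1 : E''.dim = 1) (hd'' : 0 < d'')
    (hχ'' : χ'' ≫ χ'' = -(d'' • 𝟙 E''))
    (hno' : ∀ z ∈ Subalgebra.center ℚ Y.endAlgebra, z * z ≠ -((d' : ℚ) • 1))
    (hno'' : ∀ z ∈ Subalgebra.center ℚ Y.endAlgebra, z * z ≠ -((d'' : ℚ) • 1))
    (hnoE' : ∀ z ∈ Subalgebra.center ℚ E'.endAlgebra, z * z ≠ -((d'' : ℚ) • 1)) :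
    IsStablyNondegenerate ((Y.prod E').prod E'') := by
  have hY0 : 0 < Y.dim := by rw [hY4]; norm_num
  have hE's : E'.IsSimple := isSimple_of_dim_le_one hE'1.le
  have hE'0 : 0 < E'.dim := by rw [hE'1]; norm_num
  exact ((AbelianVariety.isStablyNondegenerate_of_quarticCM Y hYs φY hE4 h11 h22 h12 h12' h1 h1' h2 hY4).prod_cmCurve_of_isSimple
    hYs hY0 hE'1 χ' hd' hχ' hno').prod_prod_cmCurve_of_isSimple hYs hY0 hE's hE'0 hE''1 χ'' hd'' hχ'' hno'' hnoE'

/-! ## §2 Every `A ∼ Y × (E′ × E″)`: `B = D` on all powers and the Hodge conjecture -/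

/-- **Every `A ∼ Y × (E′ × E″)` (no-embedding data) is stably nondegenerate** (`(Y × E′) × E″ ∼ Y × (E′ × E″)`,
`isIsogenous_prod_assoc`; isogeny invariance `IsStablyNondegenerate.of_isIsogenous`).
[cite: MoonenZarhin1999LowDim, §3 Prop. (3.8) and Thm. (3.2)] [cite: vanGeemen1994HodgeAV, §3.6 and Lemma 3.7] -/
theorem isStablyNondegenerate_row25_cmCurves_of_noEmbedding {A : AbelianVariety ℂ} (hYs : Y.IsSimple)
    (hE4 : Module.finrank ℚ Y.endAlgebra = 4) (h11 : starRingEnd ℂ μ₁ ≠ μ₁) (h22 : starRingEnd ℂ μ₂ ≠ μ₂) (h12 : μ₂ ≠ μ₁)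
    (h12' : μ₂ ≠ starRingEnd ℂ μ₁) (h1 : eigenMultiplicity Y φY μ₁ = 1)
    (h1' : eigenMultiplicity Y φY (starRingEnd ℂ μ₁) = 1) (h2 : eigenMultiplicity Y φY μ₂ = 2) (hY4 : Y.dim = 4)
    (hE'1 : E'.dim = 1) (hd' : 0 < d') (hχ' : χ' ≫ χ' = -(d' • 𝟙 E')) (hE''1 : E''.dim = 1) (hd'' : 0 < d'')
    (hχ'' : χ'' ≫ χ'' = -(d'' • 𝟙 E''))
    (hno' : ∀ z ∈ Subalgebra.center ℚ Y.endAlgebra, z * z ≠ -((d' : ℚ) • 1))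
    (hno'' : ∀ z ∈ Subalgebra.center ℚ Y.endAlgebra, z * z ≠ -((d'' : ℚ) • 1))
    (hnoE' : ∀ z ∈ Subalgebra.center ℚ E'.endAlgebra, z * z ≠ -((d'' : ℚ) • 1))
    (hA : IsIsogenous A (Y.prod (E'.prod E''))) : IsStablyNondegenerate A :=
  (isStablyNondegenerate_quarticCentre_prod_cmCurve_prod_cmCurve hYs hE4 h11 h22 h12 h12' h1 h1' h2 hY4 hE'1 hd' hχ' hE''1
    hd'' hχ'' hno' hno'' hnoE').of_isIsogenous (hA.trans (isIsogenous_prod_assoc Y E' E'').symm')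

/-- **The Hodge conjecture at every `A ∼ Y × (E′ × E″)` with the no-embedding data — UNCONDITIONAL** (`B = D` + Lefschetz
`(1,1)`). [cite: MoonenZarhin1999LowDim, §3 Prop. (3.8) and Thm. (3.2)] [cite: vanGeemen1994HodgeAV, §2.4 and Lemma 3.7] -/
theorem hodgeConjectureFor_row25_cmCurves_of_noEmbedding {A : AbelianVariety ℂ} (hYs : Y.IsSimple)
    (hE4 : Module.finrank ℚ Y.endAlgebra = 4) (h11 : starRingEnd ℂ μ₁ ≠ μ₁) (h22 : starRingEnd ℂ μ₂ ≠ μ₂) (h12 : μ₂ ≠ μ₁)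
    (h12' : μ₂ ≠ starRingEnd ℂ μ₁) (h1 : eigenMultiplicity Y φY μ₁ = 1)
    (h1' : eigenMultiplicity Y φY (starRingEnd ℂ μ₁) = 1) (h2 : eigenMultiplicity Y φY μ₂ = 2) (hY4 : Y.dim = 4)
    (hE'1 : E'.dim = 1) (hd' : 0 < d') (hχ' : χ' ≫ χ' = -(d' • 𝟙 E')) (hE''1 : E''.dim = 1) (hd'' : 0 < d'')
    (hχ'' : χ'' ≫ χ'' = -(d'' • 𝟙 E''))
    (hno' : ∀ z ∈ Subalgebra.center ℚ Y.endAlgebra, z * z ≠ -((d' : ℚ) • 1))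
    (hno'' : ∀ z ∈ Subalgebra.center ℚ Y.endAlgebra, z * z ≠ -((d'' : ℚ) • 1))
    (hnoE' : ∀ z ∈ Subalgebra.center ℚ E'.endAlgebra, z * z ≠ -((d'' : ℚ) • 1))
    (hA : IsIsogenous A (Y.prod (E'.prod E''))) : HodgeConjectureFor A.dim A.X :=
  (isStablyNondegenerate_row25_cmCurves_of_noEmbedding hYs hE4 h11 h22 h12 h12' h1 h1' h2 hY4 hE'1 hd' hχ' hE''1 hd'' hχ''
    hno' hno'' hnoE' hA).hodgeConjectureFor

/-! ## §3 These members are OUTSIDE the narrowed K3P binder class of `SixfoldTableXCoverK3PDegenerate` -/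

/-- **Kernel certificate**: every `A ∼ Y × (E′ × E″)` with the no-embedding data is NOT in the class
`{A in the K3P cell : ¬ IsStablyNondegenerate A}` on which the narrowed cover `hcAtDim_six_of_tableX_k3pDegenerate` demands
HC. [cite: MoonenZarhin1999LowDim, §3 Prop. (3.8) and Thm. (3.2)] [cite: vanGeemen1994HodgeAV, §2.4 and §3.6] -/
theorem not_k3pDegenerate_of_quarticCentre_prod_cmCurves {A : AbelianVariety ℂ} (hYs : Y.IsSimple)
    (hE4 : Module.finrank ℚ Y.endAlgebra = 4) (h11 : starRingEnd ℂ μ₁ ≠ μ₁) (h22 : starRingEnd ℂ μ₂ ≠ μ₂) (h12 : μ₂ ≠ μ₁)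
    (h12' : μ₂ ≠ starRingEnd ℂ μ₁) (h1 : eigenMultiplicity Y φY μ₁ = 1)
    (h1' : eigenMultiplicity Y φY (starRingEnd ℂ μ₁) = 1) (h2 : eigenMultiplicity Y φY μ₂ = 2) (hY4 : Y.dim = 4)
    (hE'1 : E'.dim = 1) (hd' : 0 < d') (hχ' : χ' ≫ χ' = -(d' • 𝟙 E')) (hE''1 : E''.dim = 1) (hd'' : 0 < d'')
    (hχ'' : χ'' ≫ χ'' = -(d'' • 𝟙 E''))
    (hno' : ∀ z ∈ Subalgebra.center ℚ Y.endAlgebra, z * z ≠ -((d' : ℚ) • 1))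
    (hno'' : ∀ z ∈ Subalgebra.center ℚ Y.endAlgebra, z * z ≠ -((d'' : ℚ) • 1))
    (hnoE' : ∀ z ∈ Subalgebra.center ℚ E'.endAlgebra, z * z ≠ -((d'' : ℚ) • 1))
    (hA : IsIsogenous A (Y.prod (E'.prod E''))) :
    ¬ (ProdCMCell IsQuarticFieldTypeIVFourfold (fun Z ↦ Z.dim = 2) A ∧ ¬ IsStablyNondegenerate A) := fun h ↦
  h.2 (isStablyNondegenerate_row25_cmCurves_of_noEmbedding hYs hE4 h11 h22 h12 h12' h1 h1' h2 hY4 hE'1 hd' hχ' hE''1 hd'' hχ''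
    hno' hno'' hnoE' hA)

/-! ## §4 The same CM field twice: `Y × (E′ × E′)` and `Y × (E′ × E″)` with `E″ ∼ E′` (retract of a power of `Y × E′`) -/

/-- **`Y × (E′ × E′)` is stably nondegenerate when `ℚ(√-d′)` does not embed into the centre of `End⁰(Y)`**: `Y × E′` is stably
nondegenerate (Moonen–Zarhin Prop. (3.8), `IsStablyNondegenerate.prod_cmCurve_of_isSimple`), and `Y × E′² = Y^{0+1} × E′^{1+1}` is
a mixed power, a retract of `(Y × E′)²` (`IsStablyNondegenerate.powSucc_prod_powSucc`). UNCONDITIONAL.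
[cite: MoonenZarhin1999LowDim, §3 Prop. (3.8) and Thm. (3.2)] [cite: vanGeemen1994HodgeAV, §2.4–2.5 (p. 235) and §3.6–3.7 (p. 236)] -/
theorem isStablyNondegenerate_quarticCentre_prod_cmCurve_sq (hYs : Y.IsSimple)
    (hE4 : Module.finrank ℚ Y.endAlgebra = 4) (h11 : starRingEnd ℂ μ₁ ≠ μ₁) (h22 : starRingEnd ℂ μ₂ ≠ μ₂) (h12 : μ₂ ≠ μ₁)
    (h12' : μ₂ ≠ starRingEnd ℂ μ₁) (h1 : eigenMultiplicity Y φY μ₁ = 1)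
    (h1' : eigenMultiplicity Y φY (starRingEnd ℂ μ₁) = 1) (h2 : eigenMultiplicity Y φY μ₂ = 2) (hY4 : Y.dim = 4)
    (hE'1 : E'.dim = 1) (hd' : 0 < d') (hχ' : χ' ≫ χ' = -(d' • 𝟙 E'))
    (hno' : ∀ z ∈ Subalgebra.center ℚ Y.endAlgebra, z * z ≠ -((d' : ℚ) • 1)) :
    IsStablyNondegenerate (Y.prod (E'.prod E')) := by
  have hY0 : 0 < Y.dim := by rw [hY4]; norm_num
  have h := ((AbelianVariety.isStablyNondegenerate_of_quarticCM Y hYs φY hE4 h11 h22 h12 h12' h1 h1' h2 hY4).prod_cmCurve_of_isSimple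
    hYs hY0 hE'1 χ' hd' hχ' hno').powSucc_prod_powSucc 0 1
  rwa [powSucc_succ, powSucc_zero, powSucc_zero] at h

/-- **Every `A ∼ Y × (E′ × E″)` with `E″ ∼ E′` and `ℚ(√-d′) ⊄ Z(End⁰ Y)` is stably nondegenerate** (the same-CM-field-twice
members: isogeny `Y × (E′ × E″) ∼ Y × (E′ × E′)` and §4). [cite: MoonenZarhin1999LowDim, §3 Prop. (3.8) and Thm. (3.2)]
[cite: vanGeemen1994HodgeAV, §3.6–3.7 (p. 236)] -/
theorem isStablyNondegenerate_row25_cmCurves_of_isIsogenous {A : AbelianVariety ℂ} (hYs : Y.IsSimple)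
    (hE4 : Module.finrank ℚ Y.endAlgebra = 4) (h11 : starRingEnd ℂ μ₁ ≠ μ₁) (h22 : starRingEnd ℂ μ₂ ≠ μ₂) (h12 : μ₂ ≠ μ₁)
    (h12' : μ₂ ≠ starRingEnd ℂ μ₁) (h1 : eigenMultiplicity Y φY μ₁ = 1)
    (h1' : eigenMultiplicity Y φY (starRingEnd ℂ μ₁) = 1) (h2 : eigenMultiplicity Y φY μ₂ = 2) (hY4 : Y.dim = 4)
    (hE'1 : E'.dim = 1) (hd' : 0 < d') (hχ' : χ' ≫ χ' = -(d' • 𝟙 E'))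
    (hno' : ∀ z ∈ Subalgebra.center ℚ Y.endAlgebra, z * z ≠ -((d' : ℚ) • 1)) (hE : IsIsogenous E'' E')
    (hA : IsIsogenous A (Y.prod (E'.prod E''))) : IsStablyNondegenerate A :=
  (isStablyNondegenerate_quarticCentre_prod_cmCurve_sq hYs hE4 h11 h22 h12 h12' h1 h1' h2 hY4 hE'1 hd' hχ' hno').of_isIsogenous
    (hA.trans ((IsIsogenous.refl Y).prod ((IsIsogenous.refl E').prod hE)))

/-- **The Hodge conjecture at every `A ∼ Y × (E′ × E″)`, `E″ ∼ E′`, `ℚ(√-d′) ⊄ Z(End⁰ Y)` — UNCONDITIONAL.**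
[cite: MoonenZarhin1999LowDim, §3 Prop. (3.8) and Thm. (3.2)] [cite: vanGeemen1994HodgeAV, §2.4 and Lemma 3.7] -/
theorem hodgeConjectureFor_row25_cmCurves_of_isIsogenous {A : AbelianVariety ℂ} (hYs : Y.IsSimple)
    (hE4 : Module.finrank ℚ Y.endAlgebra = 4) (h11 : starRingEnd ℂ μ₁ ≠ μ₁) (h22 : starRingEnd ℂ μ₂ ≠ μ₂) (h12 : μ₂ ≠ μ₁)
    (h12' : μ₂ ≠ starRingEnd ℂ μ₁) (h1 : eigenMultiplicity Y φY μ₁ = 1)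
    (h1' : eigenMultiplicity Y φY (starRingEnd ℂ μ₁) = 1) (h2 : eigenMultiplicity Y φY μ₂ = 2) (hY4 : Y.dim = 4)
    (hE'1 : E'.dim = 1) (hd' : 0 < d') (hχ' : χ' ≫ χ' = -(d' • 𝟙 E'))
    (hno' : ∀ z ∈ Subalgebra.center ℚ Y.endAlgebra, z * z ≠ -((d' : ℚ) • 1)) (hE : IsIsogenous E'' E')
    (hA : IsIsogenous A (Y.prod (E'.prod E''))) : HodgeConjectureFor A.dim A.X :=
  (isStablyNondegenerate_row25_cmCurves_of_isIsogenous hYs hE4 h11 h22 h12 h12' h1 h1' h2 hY4 hE'1 hd' hχ' hno' hE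
    hA).hodgeConjectureFor

/-- **Kernel certificate, same-field-twice members**: every `A ∼ Y × (E′ × E″)` with `E″ ∼ E′` and `ℚ(√-d′) ⊄ Z(End⁰ Y)` lies
OUTSIDE the narrowed K3P binder class of `SixfoldTableXCoverK3PDegenerate`. [cite: MoonenZarhin1999LowDim, §3 Prop. (3.8) and Thm. (3.2)]
[cite: vanGeemen1994HodgeAV, §2.4 and §3.6] -/
theorem not_k3pDegenerate_of_quarticCentre_prod_cmCurves_of_isIsogenous {A : AbelianVariety ℂ} (hYs : Y.IsSimple)
    (hE4 : Module.finrank ℚ Y.endAlgebra = 4) (h11 : starRingEnd ℂ μ₁ ≠ μ₁) (h22 : starRingEnd ℂ μ₂ ≠ μ₂) (h12 : μ₂ ≠ μ₁)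
    (h12' : μ₂ ≠ starRingEnd ℂ μ₁) (h1 : eigenMultiplicity Y φY μ₁ = 1)
    (h1' : eigenMultiplicity Y φY (starRingEnd ℂ μ₁) = 1) (h2 : eigenMultiplicity Y φY μ₂ = 2) (hY4 : Y.dim = 4)
    (hE'1 : E'.dim = 1) (hd' : 0 < d') (hχ' : χ' ≫ χ' = -(d' • 𝟙 E'))
    (hno' : ∀ z ∈ Subalgebra.center ℚ Y.endAlgebra, z * z ≠ -((d' : ℚ) • 1)) (hE : IsIsogenous E'' E')
    (hA : IsIsogenous A (Y.prod (E'.prod E''))) :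
    ¬ (ProdCMCell IsQuarticFieldTypeIVFourfold (fun Z ↦ Z.dim = 2) A ∧ ¬ IsStablyNondegenerate A) := fun h ↦
  h.2 (isStablyNondegenerate_row25_cmCurves_of_isIsogenous hYs hE4 h11 h22 h12 h12' h1 h1' h2 hY4 hE'1 hd' hχ' hno' hE hA)

end CMCurves

/- Audit (on path): HC for these sixfolds is a case of the summit — the tree's
`WeilTypeLadder.hodgeConjectureFor_abelianVariety_of_hodgeConjecture`, not re-declared (gate dedup). -/
example (h : _root_.HodgeConjecture) (A : AbelianVariety ℂ) : HodgeConjectureFor A.dim A.X :=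
  hcOnClass_of_hodgeConjecture (fun _ ↦ True) h A trivial

end Summit.HodgeConjecture.HodgeConjecture.TableX

end
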